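import Mathlib.AlgebraicGeometry.EllipticCurve.VariableChange
import Literature.NumberTheory.EllipticCurves.QuadraticTwist
import HarnessLib

/-!
# The integral model of the quadratic twist by `d = 4k + 1`

Let `W : y² + a₁xy + a₃y = x³ + a₂x² + a₄x + a₆` be a Weierstrass equation over a commutative ring
`R` and `k : R`; put `d := 4k + 1`. The Weierstrass equation

`W.twistModel k : y² + a₁xy + d a₃ y = x³ + (d a₂ + k a₁²) x² + (d² a₄ + 2kd a₁a₃) x + (d³ a₆ + k d² a₃²)`

has `b₂, b₄, b₆, b₈, c₄, c₆, Δ` equal to `d, d², d³, d⁴, d², d³, d⁶` times those of `W`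
(`twistModel_b₂`, …, `twistModel_Δ`), and over a field of characteristic `≠ 2` it is isomorphic, by
the change of variables `(1; 0, -a₁/2, -d a₃/2)` completing the square, to the quadratic twist
`W.quadraticTwist d` of `Literature.NumberTheory.EllipticCurves.QuadraticTwist`
(`exists_variableChange_twistModel_eq_quadraticTwist`). This is the classical *integral* model of
the quadratic twist `E^{(d)}` of an integral `E` by `d ≡ 1 (mod 4)` (Connell, *Elliptic Curve
Handbook* (1999), §4.3, "qtwist"; Comalada, *Twists and reduction of an elliptic curve*,
J. Number Theory 49 (1994); it is the model behind `N(E^{(d)}) = N(E) d²` for `(d, 4N) = 1`).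

The point of the parametrisation by `k` (rather than `d`) is that everything is polynomial in
`k` and the coefficients of `W`, over any commutative ring:

* `twistModel_zero`: `W.twistModel 0 = W`;
* `twistModel_twistModel`: `(W.twistModel k).twistModel k' = W.twistModel (4kk' + k + k')`
  (twisting by `d` then `d'` is twisting by `dd' = 4(4kk' + k + k') + 1`, on the nose), so that for a
  unit `d` the operation is invertible (`twistModel_twistModel_neg_mul_inv`: the inverse twist is
  by `d⁻¹ = 4k' + 1`, `k' = -k d⁻¹`);
* `twistModel_smul`: `(C • W).twistModel k = (VariableChange.twistMap k C) • W.twistModel k` for the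
  monoid endomorphism `twistMap k (u; r, s, t) = (u; d r, s, d t)` of `VariableChange R`;
* `map_twistModel`: compatibility with ring homomorphisms.

These are the facts used to transport minimality and Tate's algorithm along an unramified
quadratic twist (a twist by a `v`-adic unit `d ≡ 1 (mod 4)`).

## Design notes

* Declarations are dot-notation extensions of Mathlib's `WeierstrassCurve` and
  `WeierstrassCurve.VariableChange` namespaces (as in `QuadraticTwist`), deliberately.
* Mathlib has no quadratic twist (searched `twist` in `Mathlib/AlgebraicGeometry/EllipticCurve`);
  the tree's `WeierstrassCurve.quadraticTwist` is the completed-square model over a field, which is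
  not integral at `2`; the present file supplies the integral companion and does not duplicate it.

## References

* I. Connell, *Elliptic Curve Handbook*, McGill (1999), §4.3.
* S. Comalada, *Twists and reduction of an elliptic curve*, J. Number Theory 49 (1994), 45–62.
* J. H. Silverman, *The Arithmetic of Elliptic Curves*, 2nd ed. (2009), III.1 (the `b`- and
  `c`-invariants), X.2 Prop. 2.4, X.5 Cor. 5.4 (quadratic twists).
-/

namespace WeierstrassCurve

section Ring

variable {R : Type*} [CommRing R] (W : WeierstrassCurve R) (k : R)

/-- The *integral twist model* of `W` by `d = 4k + 1`: the Weierstrass equation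
`y² + a₁xy + d a₃ y = x³ + (d a₂ + k a₁²) x² + (d² a₄ + 2kd a₁a₃) x + (d³ a₆ + k d² a₃²)`.
Its `b`-invariants are `d b₂, d² b₄, d³ b₆, d⁴ b₈`, so `c₄ ↦ d² c₄`, `c₆ ↦ d³ c₆`, `Δ ↦ d⁶ Δ`, and
over a field of characteristic `≠ 2` it is isomorphic to the quadratic twist `W.quadraticTwist d`
(`exists_variableChange_twistModel_eq_quadraticTwist`). For `W` integral and `d ≡ 1 (mod 4)` an
integer this is an integral model of `E^{(d)}` (Connell, *Elliptic Curve Handbook* §4.3; Comalada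
1994). (Dot-notation extension of the Mathlib namespace `WeierstrassCurve`.) [folklore] -/
def twistModel : WeierstrassCurve R :=
  ⟨W.a₁, (4 * k + 1) * W.a₂ + k * W.a₁ ^ 2, (4 * k + 1) * W.a₃,
    (4 * k + 1) ^ 2 * W.a₄ + 2 * k * (4 * k + 1) * W.a₁ * W.a₃,
    (4 * k + 1) ^ 3 * W.a₆ + k * (4 * k + 1) ^ 2 * W.a₃ ^ 2⟩

/-- `a₁` of the twist model: unchanged. [folklore] -/
@[simp]
lemma twistModel_a₁ : (W.twistModel k).a₁ = W.a₁ := rfl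

/-- `a₂` of the twist model: `d a₂ + k a₁²`. [folklore] -/
@[simp]
lemma twistModel_a₂ : (W.twistModel k).a₂ = (4 * k + 1) * W.a₂ + k * W.a₁ ^ 2 := rfl

/-- `a₃` of the twist model: `d a₃`. [folklore] -/
@[simp]
lemma twistModel_a₃ : (W.twistModel k).a₃ = (4 * k + 1) * W.a₃ := rfl

/-- `a₄` of the twist model: `d² a₄ + 2kd a₁ a₃`. [folklore] -/
@[simp]
lemma twistModel_a₄ :
    (W.twistModel k).a₄ = (4 * k + 1) ^ 2 * W.a₄ + 2 * k * (4 * k + 1) * W.a₁ * W.a₃ := rfl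

/-- `a₆` of the twist model: `d³ a₆ + k d² a₃²`. [folklore] -/
@[simp]
lemma twistModel_a₆ :
    (W.twistModel k).a₆ = (4 * k + 1) ^ 3 * W.a₆ + k * (4 * k + 1) ^ 2 * W.a₃ ^ 2 := rfl

/-- `b₂` of the twist model is `d b₂` (Silverman, *AEC* III.1). [folklore] -/
@[simp]
lemma twistModel_b₂ : (W.twistModel k).b₂ = (4 * k + 1) * W.b₂ := by
  simp only [b₂, twistModel_a₁, twistModel_a₂]
  ring

/-- `b₄` of the twist model is `d² b₄` (Silverman, *AEC* III.1). [folklore] -/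
@[simp]
lemma twistModel_b₄ : (W.twistModel k).b₄ = (4 * k + 1) ^ 2 * W.b₄ := by
  simp only [b₄, twistModel_a₁, twistModel_a₃, twistModel_a₄]
  ring

/-- `b₆` of the twist model is `d³ b₆` (Silverman, *AEC* III.1). [folklore] -/
@[simp]
lemma twistModel_b₆ : (W.twistModel k).b₆ = (4 * k + 1) ^ 3 * W.b₆ := by
  simp only [b₆, twistModel_a₃, twistModel_a₆]
  ring

/-- `b₈` of the twist model is `d⁴ b₈` (Silverman, *AEC* III.1). [folklore] -/
@[simp]
lemma twistModel_b₈ : (W.twistModel k).b₈ = (4 * k + 1) ^ 4 * W.b₈ := by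
  simp only [b₈, twistModel_a₁, twistModel_a₂, twistModel_a₃, twistModel_a₄, twistModel_a₆]
  ring

/-- `c₄` of the twist model is `d² c₄` (Silverman, *AEC* III.1). [folklore] -/
@[simp]
lemma twistModel_c₄ : (W.twistModel k).c₄ = (4 * k + 1) ^ 2 * W.c₄ := by
  simp only [c₄, twistModel_b₂, twistModel_b₄]
  ring

/-- `c₆` of the twist model is `d³ c₆` (Silverman, *AEC* III.1). [folklore] -/
@[simp]
lemma twistModel_c₆ : (W.twistModel k).c₆ = (4 * k + 1) ^ 3 * W.c₆ := by
  simp only [c₆, twistModel_b₂, twistModel_b₄, twistModel_b₆]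
  ring

/-- `Δ` of the twist model is `d⁶ Δ` (Silverman, *AEC* III.1). [folklore] -/
@[simp]
lemma twistModel_Δ : (W.twistModel k).Δ = (4 * k + 1) ^ 6 * W.Δ := by
  simp only [Δ, twistModel_b₂, twistModel_b₄, twistModel_b₆, twistModel_b₈]
  ring

/-- Twisting by `d = 1` (`k = 0`) does nothing, on the nose. [folklore] -/
@[simp]
lemma twistModel_zero : W.twistModel 0 = W := by
  ext <;> simp only [twistModel_a₁, twistModel_a₂, twistModel_a₃, twistModel_a₄, twistModel_a₆] <;>
    ring

/-- Twisting by `d = 4k + 1` and then by `d' = 4k' + 1` is twisting by `dd' = 4(4kk' + k + k') + 1`,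
on the nose. [folklore] -/
lemma twistModel_twistModel (k' : R) :
    (W.twistModel k).twistModel k' = W.twistModel (4 * k * k' + k + k') := by
  ext <;> simp only [twistModel_a₁, twistModel_a₂, twistModel_a₃, twistModel_a₄, twistModel_a₆] <;>
    ring

/-- For a unit `d = 4k + 1`, twisting by `d` and then by `d⁻¹ = 4k' + 1`, `k' = -k d⁻¹`, gives
back `W` on the nose: the twist model operation by a unit is invertible. [folklore] -/
lemma twistModel_twistModel_neg_mul_inv (hd : IsUnit (4 * k + 1)) :
    (W.twistModel k).twistModel (-k * ↑hd.unit⁻¹) = W := by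
  rw [twistModel_twistModel]
  have h : 4 * k * (-k * ↑hd.unit⁻¹) + k + -k * ↑hd.unit⁻¹ = 0 := by
    have h1 : (4 * k + 1) * (↑hd.unit⁻¹ : R) = 1 := hd.mul_val_inv
    linear_combination (-k) * h1
  rw [h, twistModel_zero]

/-- The twist model commutes with ring homomorphisms. [folklore] -/
lemma map_twistModel {S : Type*} [CommRing S] (f : R →+* S) :
    (W.twistModel k).map f = (W.map f).twistModel (f k) := by
  ext <;> simp [twistModel, map_ofNat]

/-- The monoid endomorphism `(u; r, s, t) ↦ (u; d r, s, d t)` (`d = 4k + 1`) of the group of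
admissible changes of variables, which intertwines the twist model with changes of variables
(`twistModel_smul`). (Dot-notation extension of the Mathlib namespace
`WeierstrassCurve.VariableChange`.) [folklore] -/
def VariableChange.twistMap (k : R) : VariableChange R →* VariableChange R where
  toFun C := ⟨C.u, (4 * k + 1) * C.r, C.s, (4 * k + 1) * C.t⟩
  map_one' := by
    simp only [VariableChange.one_def, mul_zero]
  map_mul' C C' := by
    simp only [VariableChange.mul_def]
    ext <;> dsimp only <;> ring

/-- `u` of `twistMap k C` is `u`. [folklore] -/
@[simp]
lemma VariableChange.twistMap_u (C : VariableChange R) : (VariableChange.twistMap k C).u = C.u := rfl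

/-- `r` of `twistMap k C` is `d r`. [folklore] -/
@[simp]
lemma VariableChange.twistMap_r (C : VariableChange R) :
    (VariableChange.twistMap k C).r = (4 * k + 1) * C.r := rfl

/-- `s` of `twistMap k C` is `s`. [folklore] -/
@[simp]
lemma VariableChange.twistMap_s (C : VariableChange R) : (VariableChange.twistMap k C).s = C.s := rfl

/-- `t` of `twistMap k C` is `d t`. [folklore] -/
@[simp]
lemma VariableChange.twistMap_t (C : VariableChange R) :
    (VariableChange.twistMap k C).t = (4 * k + 1) * C.t := rfl

/-- **The twist model intertwines changes of variables**: twisting `C • W` by `d = 4k + 1` is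
changing variables in `W.twistModel k` by `(u; d r, s, d t)`. (A polynomial identity in `k`, the
coefficients and `u⁻¹, r, s, t`.) [folklore] -/
lemma twistModel_smul (C : VariableChange R) :
    (C • W).twistModel k = VariableChange.twistMap k C • W.twistModel k := by
  ext
  · simp only [twistModel_a₁, variableChange_a₁, VariableChange.twistMap_u,
      VariableChange.twistMap_s]
  · simp only [twistModel_a₂, variableChange_a₂, variableChange_a₁, twistModel_a₁,
      VariableChange.twistMap_u, VariableChange.twistMap_r, VariableChange.twistMap_s]
    ring
  · simp only [twistModel_a₃, variableChange_a₃, twistModel_a₁, VariableChange.twistMap_u,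
      VariableChange.twistMap_r, VariableChange.twistMap_t]
    ring
  · simp only [twistModel_a₄, variableChange_a₄, variableChange_a₁, variableChange_a₃,
      twistModel_a₁, twistModel_a₂, twistModel_a₃, VariableChange.twistMap_u,
      VariableChange.twistMap_r, VariableChange.twistMap_s, VariableChange.twistMap_t]
    ring
  · simp only [twistModel_a₆, variableChange_a₆, variableChange_a₃, twistModel_a₁, twistModel_a₂,
      twistModel_a₃, twistModel_a₄, VariableChange.twistMap_u, VariableChange.twistMap_r,
      VariableChange.twistMap_t]
    ring

end Ring

section Field

variable {F : Type*} [Field F] [NeZero (2 : F)] (W : WeierstrassCurve F) (k : F)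

/-- Over a field of characteristic `≠ 2`, completing the square `(1; 0, -a₁/2, -d a₃/2)` takes the
twist model by `d = 4k + 1` to the quadratic twist `W.quadraticTwist d`
(`y² = x³ + d(b₂/4)x² + d²(b₄/2)x + d³(b₆/4)`): the twist model is a model of `E^{(d)}`
(Silverman, *AEC* X.2 Prop. 2.4, X.5 Cor. 5.4). [folklore] -/
theorem exists_variableChange_twistModel_eq_quadraticTwist :
    ∃ C : VariableChange F, C.u = 1 ∧ C • W.twistModel k = W.quadraticTwist (4 * k + 1) := by
  have h2 : (2 : F) ≠ 0 := two_ne_zero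
  have h4 : (4 : F) ≠ 0 := by
    rw [show (4 : F) = 2 * 2 by norm_num]
    exact mul_ne_zero h2 h2
  refine ⟨⟨1, 0, -W.a₁ / 2, -((4 * k + 1) * W.a₃) / 2⟩, rfl, ?_⟩
  ext
  · simp only [variableChange_a₁, twistModel_a₁, quadraticTwist_a₁, inv_one, Units.val_one]
    field_simp
    ring
  · simp only [variableChange_a₂, twistModel_a₁, twistModel_a₂, quadraticTwist_a₂, b₂, inv_one,
      Units.val_one]
    field_simp
    ring
  · simp only [variableChange_a₃, twistModel_a₁, twistModel_a₃, quadraticTwist_a₃, inv_one,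
      Units.val_one]
    field_simp
    ring
  · simp only [variableChange_a₄, twistModel_a₁, twistModel_a₂, twistModel_a₃, twistModel_a₄,
      quadraticTwist_a₄, b₄, inv_one, Units.val_one]
    field_simp
    ring
  · simp only [variableChange_a₆, twistModel_a₁, twistModel_a₂, twistModel_a₃, twistModel_a₄,
      twistModel_a₆, quadraticTwist_a₆, b₆, inv_one, Units.val_one]
    field_simp
    ring

end Field

end WeierstrassCurve
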